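import Summits.QuantumAdvantage.AdviceFreeQNC0.ClaimKTransversal39
import Summits.QuantumAdvantage.AdviceFreeQNC0.AffBells23Transversal
import HarnessLib

/-!
# Cell qa-qnc0, `p = 3` — Claim K (`Blind39.FewTermJuntaBound`) for families of small CO-READ DEGREE (Caro–Wei; prover qn-prover-3 g26,
# sequel of `ClaimKTransversal39`)

`ClaimKTransversal39.norm_twistedParity_le_of_transversal` bounds the twisted parity sum of ANY junta family by `(√3/2)^{#A}` for a
transversal `A` of the reading sets inside the covered twisted letters.  With the tree's Caro–Wei lemma (`AffBells23.exists_indep_caroWei`)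
a transversal of size `≥ ⌈wU/(Δ+1)⌉` exists as soon as every covered twisted letter is co-read with at most `Δ` other covered twisted
letters.  Hence:

* **`Blind39.norm_twistedParity_le_of_coDegree`** — `‖Σ_x ω^{⟨β,x⟩}(−1)^{#{k : f k x}}‖ ≤ (√3/2)^{⌈wU/(Δ+1)⌉}·2^{−(wt β − wU)}·2^N`;
* **`Blind39.fewTermJuntaBound_of_coDegree`** — the inequality of Claim K with `κ = √3/2`, `C = 1` for every family of `s`-juntas in
  which every covered twisted letter has fewer than `s` co-read partners among the covered twisted letters (no bound on `M`).

Together with `fewTermJuntaBound_irredundant` this leaves, as for (R1), exactly the REDUNDANT pair-dense families open.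

WHAT THIS IS NOT: Claim K itself stays open; crux `stmt-QuantumAdvantage-22907` untouched.
-/

noncomputable section

namespace Summit.QuantumAdvantage.AdviceFreeQNC0

open Finset Literature.Computability.MetaComplexity

namespace Blind39

variable {N : ℕ}

/-- **Claim K up to CO-READ DEGREE.**  If every covered twisted letter is co-read (lies in a common `T k`) with at most `Δ` other covered
twisted letters, then `‖Σ_x ω^{⟨β,x⟩}(−1)^{#{k : f k x}}‖ ≤ (√3/2)^{⌈wU/(Δ+1)⌉}·2^{−(wt β − wU)}·2^N`. -/
theorem norm_twistedParity_le_of_coDegree {M : ℕ} (T : Fin M → Finset (Fin N)) (f : Fin M → (Fin N → Bool) → Bool)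
    (hf : ∀ k (x x' : Fin N → Bool), (∀ i ∈ T k, x i = x' i) → f k x = f k x') (β : Fin N → ZMod 3) (Δ : ℕ)
    (hco : ∀ i ∈ (univ.biUnion T).filter (fun i => β i ≠ 0),
      (((univ.biUnion T).filter (fun i => β i ≠ 0)).filter
        fun i' => i' ≠ i ∧ ∃ k, i ∈ T k ∧ i' ∈ T k).card ≤ Δ) :
    ‖∑ x : Fin N → Bool, (ZMod.stdAddChar (linVal β x) : ℂ) *
        (if (univ.filter fun k => f k x = true).card % 2 = 1 then (-1 : ℂ) else 1)‖
      ≤ (Real.sqrt 3 / 2) ^ ((((univ.biUnion T).filter fun i => β i ≠ 0).card + Δ) / (Δ + 1)) *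
          (2 : ℝ)⁻¹ ^ (wt β - ((univ.biUnion T).filter fun i => β i ≠ 0).card) * (2 : ℝ) ^ N := by
  classical
  set P := (univ.biUnion T).filter (fun i => β i ≠ 0) with hPdef
  obtain ⟨A, hAP, hfree, hsum⟩ := AffBells23.exists_indep_caroWei (univ : Finset (Fin M)) T P
  -- degrees inside `P` are at most `Δ`
  have hdeg : ∀ p ∈ P, AffBells23.cdeg (univ : Finset (Fin M)) T P p ≤ Δ := by
    intro p hp
    unfold AffBells23.cdeg
    refine le_trans (card_le_card fun q hq => ?_) (hco p hp)
    simp only [Finset.mem_filter] at hq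
    obtain ⟨hqP, hqp, k, _, hpk, hqk⟩ := hq
    exact mem_filter.mpr ⟨hqP, hqp, k, hpk, hqk⟩
  have hPA : P.card ≤ (Δ + 1) * A.card := by
    have h1 : ∑ p ∈ P, (1 : ℝ) / ((Δ : ℝ) + 1) ≤ ∑ p ∈ P, (1 : ℝ) / (AffBells23.cdeg (univ : Finset (Fin M)) T P p + 1) := by
      refine sum_le_sum fun p hp => one_div_le_one_div_of_le (by positivity) ?_
      exact_mod_cast Nat.add_le_add_right (hdeg p hp) 1
    rw [sum_const, nsmul_eq_mul] at h1
    have h2 : (P.card : ℝ) * (1 / ((Δ : ℝ) + 1)) ≤ A.card := h1.trans hsum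
    have h3 : (P.card : ℝ) ≤ ((Δ : ℝ) + 1) * A.card := by
      rw [mul_one_div, div_le_iff₀ (by positivity)] at h2
      linarith
    exact_mod_cast h3
  have hAU : A ⊆ univ.biUnion T := fun i hi => (mem_filter.mp (hAP hi)).1
  have hA : ∀ k, (T k ∩ A).card ≤ 1 := fun k => AffBells23.card_inter_le_one_of_conflictFree hfree (mem_univ k)
  have hAβ : ∀ i ∈ A, β i ≠ 0 := fun i hi => (mem_filter.mp (hAP hi)).2
  refine (norm_twistedParity_le_of_transversal T f hf β A hAU hA hAβ).trans ?_
  have hceil : (P.card + Δ) / (Δ + 1) ≤ A.card := by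
    rw [Nat.div_le_iff_le_mul_add_pred (by omega)]
    have : (Δ + 1) * A.card = A.card * (Δ + 1) := mul_comm _ _
    omega
  have hκ0 : (0 : ℝ) ≤ Real.sqrt 3 / 2 := by positivity
  have hκ1 : Real.sqrt 3 / 2 ≤ 1 := by linarith [AffBells22.sqrt_three_le]
  have hpow : (Real.sqrt 3 / 2) ^ A.card ≤ (Real.sqrt 3 / 2) ^ ((P.card + Δ) / (Δ + 1)) := pow_le_pow_of_le_one hκ0 hκ1 hceil
  have hpos : (0 : ℝ) ≤ (2 : ℝ)⁻¹ ^ (wt β - P.card) * (2 : ℝ) ^ N := by positivity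
  calc (Real.sqrt 3 / 2) ^ A.card * (2 : ℝ)⁻¹ ^ (wt β - P.card) * (2 : ℝ) ^ N
      = (Real.sqrt 3 / 2) ^ A.card * ((2 : ℝ)⁻¹ ^ (wt β - P.card) * (2 : ℝ) ^ N) := by ring
    _ ≤ (Real.sqrt 3 / 2) ^ ((P.card + Δ) / (Δ + 1)) * ((2 : ℝ)⁻¹ ^ (wt β - P.card) * (2 : ℝ) ^ N) :=
        mul_le_mul_of_nonneg_right hpow hpos
    _ = _ := by ring

/-- **CLAIM K FOR SMALL CO-READ DEGREE** (`κ = √3/2`, `C = 1`).  If every covered twisted letter has fewer than `s` co-read partners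
among the covered twisted letters (e.g. outside reads confined to cells of `≤ s` letters, any multiplicity), the inequality of
`Blind39.FewTermJuntaBound` holds — no bound on the number `M` of juntas or on their sizes is needed. -/
theorem fewTermJuntaBound_of_coDegree (s M : ℕ) (hs : 1 ≤ s) (T : Fin M → Finset (Fin N)) (f : Fin M → (Fin N → Bool) → Bool)
    (hf : ∀ k (x x' : Fin N → Bool), (∀ i ∈ T k, x i = x' i) → f k x = f k x') (β : Fin N → ZMod 3)
    (hco : ∀ i ∈ (univ.biUnion T).filter (fun i => β i ≠ 0),
      (((univ.biUnion T).filter (fun i => β i ≠ 0)).filter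
        fun i' => i' ≠ i ∧ ∃ k, i ∈ T k ∧ i' ∈ T k).card + 1 ≤ s) :
    ‖∑ x : Fin N → Bool, (ZMod.stdAddChar (linVal β x) : ℂ) *
        (if (univ.filter fun k => f k x = true).card % 2 = 1 then (-1 : ℂ) else 1)‖
      ≤ 1 * (Real.sqrt 3 / 2) ^ ((((univ.biUnion T).filter fun i => β i ≠ 0).card + s - 1) / s) *
          (2 : ℝ)⁻¹ ^ (wt β - ((univ.biUnion T).filter fun i => β i ≠ 0).card) * (2 : ℝ) ^ N := by
  have hco' : ∀ i ∈ (univ.biUnion T).filter (fun i => β i ≠ 0),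
      (((univ.biUnion T).filter (fun i => β i ≠ 0)).filter
        fun i' => i' ≠ i ∧ ∃ k, i ∈ T k ∧ i' ∈ T k).card ≤ s - 1 := by
    intro i hi; have := hco i hi; omega
  have h := norm_twistedParity_le_of_coDegree T f hf β (s - 1) hco'
  have hs1 : s - 1 + 1 = s := by omega
  have hs2 : ((univ.biUnion T).filter fun i => β i ≠ 0).card + (s - 1)
      = ((univ.biUnion T).filter fun i => β i ≠ 0).card + s - 1 := by omega
  rw [hs1, hs2] at h
  rw [one_mul]
  exact h

end Blind39

end Summit.QuantumAdvantage.AdviceFreeQNC0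

end
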